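import Summits.AtomisticToContinuum.FouriersLaw.Theses.ContactStieltjesMeasure

/-!
# IdeasK5Sketch — crux idea `contact-fisher-ceiling` (crux-ideate r2 k5, stmt-AtomisticToContinuum-15248)

First-lemma candidates of the ENTROPIC lever: statements about an ARBITRARY weak steady state of the
pinned anharmonic chain on the CLOSED parameter range `0 ≤ lam, 0 ≤ β` (so in particular on the `φ⁴` edge
`β = 0 < lam` of `CayleyPencil.stub_phi4Edge`), with no mixing, Lyapunov, uniqueness or existence input.
Definitions only (Props); nothing is proved here.
-/

noncomputable section

open MeasureTheory Filter Topology Set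
open scoped ContDiff

namespace Summit.AtomisticToContinuum.FouriersLaw.Cruxes.StieltjesRepresentation.IdeasK5

open Literature.MathematicalPhysics.KineticTheory.HeatConduction
open Literature.MathematicalPhysics.KineticTheory OscillatorChain

/-- FIRST LEMMA (`EntropicCeiling`, sharp Cramér–Rao form). For EVERY weak steady state of the pinned chain on the closed
range (`0 ≤ lam`, `0 ≤ β`, in particular the `φ⁴` edge `β = 0 < lam`), every `N ≥ 2`: the total current has the sign of
`T_L - T_R` and `2 |totalCurrent| ≤ (N-1) γ |T_L - T_R|`, i.e. per bond `0 ≤ J̃/(T_L - T_R) ≤ γ/2` AT FINITE BIAS. Mechanism: smooth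
density (Hörmander, in tree), kinetic sum rule `⟨p₀²⟩ + ⟨p²_{N-1}⟩ = T_L + T_R`, Fisher sum rule `T_L I₀ + T_R I_{N-1} ≤ 2`
(stationary entropy balance, truncated convex profiles), Cramér–Rao `⟨p_b²⟩ I_b ≥ 1`, and `J̃ = γ (T_L - ⟨p₀²⟩)` (bond = inflow);
the three combine to `a (T_L - T_R - 2a) ≥ 0` for `a = J̃/γ`. Saturated by the weakly pinned, weakly damped harmonic chain
(toy: `J̃/(γΔT/2) = 0.9975`), so `γ/2` is the optimal universal constant. [Shiraishi–Saito–Tasaki 2016; Dechant–Sasa 2018 §6, made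
rigorous and sharpened for weak steady states.] -/
def EntropicCeiling : Prop :=
  ∀ ω₂ lam β γ : ℝ, 0 < ω₂ → 0 ≤ lam → 0 ≤ β → 0 < γ → ∀ N : ℕ, 2 ≤ N →
    ∀ T_L T_R : ℝ, 0 < T_L → 0 < T_R → ∀ μ : Measure (PhaseSpace N),
      (pinnedChain ω₂ lam β γ).IsSteadyState N T_L T_R μ →
        0 ≤ (T_L - T_R) * (pinnedChain ω₂ lam β γ).totalCurrent μ ∧
          2 * |(pinnedChain ω₂ lam β γ).totalCurrent μ| ≤ ((N : ℝ) - 1) * γ * |T_L - T_R|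

/-- `ContactSumRule`: moment-free contact identities of every weak steady state — the two contact kinetic
temperatures are integrable, sum to `T_L + T_R`, and every bond carries the bath inflow `γ (T_L - ⟨p₀²⟩)`
(test functions `χ(H/n)·(1 - e^{-sH})/s` and `χ(H/n)·(1 - e^{-sE_k})/s`, `E_k` the energy left of bond `k`; the
Liouville field annihilates `χ(H/n)`, all cutoff terms are uniformly bounded; `n → ∞`, then `s ↓ 0` monotonically). -/
def ContactSumRule : Prop :=
  ∀ ω₂ lam β γ : ℝ, 0 < ω₂ → 0 ≤ lam → 0 ≤ β → 0 < γ → ∀ N : ℕ, 2 ≤ N →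
    ∀ T_L T_R : ℝ, 0 < T_L → 0 < T_R → ∀ μ : Measure (PhaseSpace N),
      (pinnedChain ω₂ lam β γ).IsSteadyState N T_L T_R μ →
        ∀ i₀ i₁ : Fin N, i₀.val = 0 → i₁.val = N - 1 →
          Integrable (fun x : PhaseSpace N => x.2 i₀ ^ 2) μ ∧
            Integrable (fun x : PhaseSpace N => x.2 i₁ ^ 2) μ ∧
            (∫ x, x.2 i₀ ^ 2 ∂μ) + (∫ x, x.2 i₁ ^ 2 ∂μ) = T_L + T_R ∧
            (pinnedChain ω₂ lam β γ).totalCurrent μ = ((N : ℝ) - 1) * γ * (T_L - ∫ x, x.2 i₀ ^ 2 ∂μ)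

/-- `ContactFisherBound`: the density-free (dual) form of the entropy balance
`Σ_b (γ/T_b) ‖p_b + T_b ∂_{p_b} log ρ‖²_{L²(μ)} ≤ J̃ (1/T_R - 1/T_L)`: for every smooth compactly supported `φ`,
`(∫ (p_b φ - T_b ∂_{p_b} φ) dμ)² ≤ (T_b/γ) · J̃ (1/T_R - 1/T_L) · ∫ φ² dμ` at both contacts. Along a steady family at
`T ± δ/2` the right-hand side is `O(δ²) ∫ φ² dμ` by `EntropicCeiling`: the contact momenta are conditionally
Maxwellian to second order, uniformly in the (uncontrolled) interior. -/
def ContactFisherBound : Prop :=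
  ∀ ω₂ lam β γ : ℝ, 0 < ω₂ → 0 ≤ lam → 0 ≤ β → 0 < γ → ∀ N : ℕ, 2 ≤ N →
    ∀ T_L T_R : ℝ, 0 < T_L → 0 < T_R → ∀ μ : Measure (PhaseSpace N),
      (pinnedChain ω₂ lam β γ).IsSteadyState N T_L T_R μ →
        ∀ i₀ i₁ : Fin N, i₀.val = 0 → i₁.val = N - 1 →
          ∀ φ : PhaseSpace N → ℝ, ContDiff ℝ ∞ φ → HasCompactSupport φ →
            (∫ x, (x.2 i₀ * φ x - T_L * partialP i₀ φ x) ∂μ) ^ 2 ≤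
                T_L / γ * ((pinnedChain ω₂ lam β γ).totalCurrent μ / ((N : ℝ) - 1) * (1 / T_R - 1 / T_L)) *
                  ∫ x, φ x ^ 2 ∂μ ∧
              (∫ x, (x.2 i₁ * φ x - T_R * partialP i₁ φ x) ∂μ) ^ 2 ≤
                T_R / γ * ((pinnedChain ω₂ lam β γ).totalCurrent μ / ((N : ℝ) - 1) * (1 / T_R - 1 / T_L)) *
                  ∫ x, φ x ^ 2 ∂μ

/-- `ResponseCeiling`: `EntropicCeiling` in the crux's own spelling — for EVERY family of weak steady states (no uniqueness,
any `N ≥ 2`, closed range incl. the `φ⁴` edge) and every bias `0 < |δ| < 2T` the crux's difference quotient lies in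
`[0, (N-1) γ/2]`: the K2 ceiling `G_N ≤ γ/2` (support item `CouplingFreeCeiling`'s constant) holds at finite bias, pointwise. -/
def ResponseCeiling : Prop :=
  ∀ ω₂ lam β γ : ℝ, 0 < ω₂ → 0 ≤ lam → 0 ≤ β → 0 < γ → ∀ N : ℕ, 2 ≤ N → ∀ T : ℝ, 0 < T →
    ∀ μ : (N' : ℕ) → ℝ → ℝ → Measure (PhaseSpace N'),
      (∀ (N' : ℕ) (T_L T_R : ℝ), 0 < T_L → 0 < T_R →
        (pinnedChain ω₂ lam β γ).IsSteadyState N' T_L T_R (μ N' T_L T_R)) →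
      ∀ δ : ℝ, δ ≠ 0 → |δ| < 2 * T →
        0 ≤ (pinnedChain ω₂ lam β γ).totalCurrent (μ N (T + δ / 2) (T - δ / 2)) / δ ∧
          (pinnedChain ω₂ lam β γ).totalCurrent (μ N (T + δ / 2) (T - δ / 2)) / δ ≤ ((N : ℝ) - 1) * (γ / 2)

/-- The glue `EntropicCeiling → ResponseCeiling` is elementary (`T ± δ/2 > 0` iff `|δ| < 2T`; `(T+δ/2) - (T-δ/2) = δ`):
the family-level ceiling in the crux's spelling needs nothing beyond the single-state lemma. -/
theorem responseCeiling_of_entropicCeiling (h : EntropicCeiling) : ResponseCeiling := by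
  intro ω₂ lam β γ hω hl hβ hγ N hN T hT μ hμ δ hδ hδT
  have hlt : |δ| < 2 * T := hδT
  have h1 : 0 < T + δ / 2 := by
    have := neg_abs_le δ
    linarith
  have h2 : 0 < T - δ / 2 := by
    have := le_abs_self δ
    linarith
  obtain ⟨hsign, habs⟩ := h ω₂ lam β γ hω hl hβ hγ N hN (T + δ / 2) (T - δ / 2) h1 h2 _ (hμ N _ _ h1 h2)
  set J := (pinnedChain ω₂ lam β γ).totalCurrent (μ N (T + δ / 2) (T - δ / 2)) with hJ
  have hd : T + δ / 2 - (T - δ / 2) = δ := by ring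
  rw [hd] at hsign habs
  have hδ2 : 0 < δ ^ 2 := by positivity
  refine ⟨?_, ?_⟩
  · have : J / δ = δ * J / δ ^ 2 := by
      field_simp
    rw [this]
    exact div_nonneg hsign hδ2.le
  · have hq : |J / δ| ≤ ((N : ℝ) - 1) * (γ / 2) := by
      rw [abs_div, div_le_iff₀ (abs_pos.mpr hδ)]
      nlinarith [habs, abs_nonneg δ]
    exact (le_abs_self _).trans hq

end Summit.AtomisticToContinuum.FouriersLaw.Cruxes.StieltjesRepresentation.IdeasK5

end
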